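import Literature.IUT.HodgeTheaters.ThetaPMEllHodgeTheatersF

/-!
# [IUTchI] §6, Remark 6.12.1: the `ℱ`-level functorial dynamics from the `𝒟`-level one and Corollary 5.3 (ii)

Mochizuki, *Inter-universal Teichmüller theory I*, §6, Remark 6.12.1 p. 174 ("By applying Corollary
6.12, a similar remark to Remark 5.6.1 may be made concerning the Θ^±-bridges, Θ^{ell}-bridges, and
Θ^{±ell}-Hodge theaters"), kurims manuscript (May 2020) ([IUTchI] Rmk 6.12.1 p.174) [claim: Mochizuki2012, status: disputed].
PROOF-ONLY companion of `ThetaPMEllHodgeTheatersF.lean`: the `ℱ`-level symmetry statement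
`FunctorialDynamicsPMF` (the analogue of Prop 6.8 (i)) is DISCHARGED from the `𝒟`-level one
`DThetaPMEllHT.EllBridgeSymmetry` (Prop 6.8 (i), abc-iut-L5-t4's named statement) and Cor 5.3 (ii)
`FKit.IsomFtoDBijective`, exactly as printed: Cor 6.12 (i) (`isoFToDBijective_of_isomFtoDBijective`)
transports isomorphisms and their count from the `𝒟`-level to the `ℱ`-level. Nothing of IUT is asserted.
-/

namespace Literature.IUT.HodgeTheaters

open CategoryTheory

universe u

namespace PMBaseKit

variable {l : ℕ} {K : PMBaseKit.{u} l} {M : K.MultKit} {FK : K.FKit M}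

namespace FKit

/-- **Rmk 6.12.1, PROVED from Prop 6.8 (i) and Cor 5.3 (ii)** ("By applying Corollary 6.12 …",
[IUTchI] Rmk 6.12.1 p. 174): the `ℱ`-level `𝔽_l^{⋊±}`-symmetry of the Θ^{ell}-bridge underlying a
Θ^{±ell}-Hodge theater. ([IUTchI] Rmk 6.12.1 p.174) [claim: Mochizuki2012, status: disputed] -/
theorem functorialDynamicsPMF_of_isomFtoDBijective (h : FK.IsomFtoDBijective)
    (hsym : ∀ H : FK.ThetaPMEllHT, DThetaPMEllHT.EllBridgeSymmetry H.dHT) :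
    FK.FunctorialDynamicsPMF := by
  intro H hV
  have hb := ThetaEllBridge.isoFToDBijective_of_isomFtoDBijective h H.ellBridge H.ellBridge
  obtain ⟨htrans, hcard⟩ := hsym H hV
  refine ⟨fun t₁ t₂ => ?_, ?_⟩
  · obtain ⟨g, hg⟩ := htrans t₁ t₂
    obtain ⟨f, hf⟩ := hb.2 g
    refine ⟨f, ?_⟩
    rw [hf]
    exact hg
  · rw [Nat.card_congr (Equiv.ofBijective _ hb)]
    exact hcard

end FKit

end PMBaseKit

end Literature.IUT.HodgeTheaters
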